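import Summits.AtomisticToContinuum.BoseEinsteinCondensation.Theses.BECGroundStateSOS

/-!
# Route `BECGroundStateSOS`, assembly item `Assembly` (stmt-AtomisticToContinuum-5246)

The route's assembly decl is the pure-logic composition

  `PeriodicEnergyFinite → PeriodicIRBound → IRModeCounting → BoundaryTransferWeak →
    BoseEinsteinCondensation`:

mode counting on the torus (`IRModeCounting`, whose two hypotheses are literally
`PeriodicEnergyFinite` and `PeriodicIRBound`) yields periodic BEC for every repulsive finite-range
`v`, and the boundary-condition transfer `BoundaryTransferWeak v` turns periodic BEC for `v` into
`∃ ρ₀ > 0, ∀ ρ ∈ (0, ρ₀), HasGroundStateBEC v ρ`, which is the `v`-instance of the summit conjunct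
`BoseEinsteinCondensation` (an `abbrev` for
`Literature.MathematicalPhysics.QuantumManyBody.BoseGas.BoseEinsteinCondensation`).
No analysis is involved; this file only records the composition so that the gate can close the
item against the exact route decl.

References: Lieb–Seiringer–Solovej–Yngvason 2005, §1.2 and Ch. 5 (the statement being assembled);
Kennedy–Lieb–Shastry 1988 (the infrared-bound mechanism behind `PeriodicIRBound`).
-/

namespace Summit.AtomisticToContinuum.BoseEinsteinCondensation.Theorems

/-- **`Assembly` holds** (settles stmt-AtomisticToContinuum-5246, exact route decl): given
`hF : PeriodicEnergyFinite`, `hX : PeriodicIRBound`, `hMC : IRModeCounting` and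
`hBT : BoundaryTransferWeak`, for every repulsive finite-range `v` the periodic BEC statement
`hMC hF hX v hv` feeds `hBT v hv`, whose conclusion is the `v`-instance of
`BoseEinsteinCondensation`. Pure composition of the route's hypotheses. [folklore] -/
theorem assembly_proof :
    Summit.AtomisticToContinuum.BoseEinsteinCondensation.Theses.BECGroundStateSOS.Assembly := by
  unfold Summit.AtomisticToContinuum.BoseEinsteinCondensation.Theses.BECGroundStateSOS.Assembly
  intro hF hX hMC hBT v hv
  exact hBT v hv (hMC hF hX v hv)

end Summit.AtomisticToContinuum.BoseEinsteinCondensation.Theorems
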